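import Literature.IUT.LogVolume.GenuineLogThetaPerImageTameContent
import HarnessLib

/-!
# The EXACT content of the (Ind1)-slot-union region `⋃_a ι_a(t_{i,v_a})·(R_I)^∼` at a TAME collection, and the exact `−|log(Θ)|_p` of the cell's
# reading of record (U) at tame primes: `hull(possible images) = packetHull(p^{min_a A_a}·log_p(R_I^×))`, `A_a = (ord t_{i,v_a} − 1) div e(v̲_a) + 1 − (j+1)`
# ([IUTchIV] Prop. 1.1, Prop. 1.2 (ii); [IUTchIII] Cor. 3.12 p. 174; Dupuy–Hilado §4.7, §4.9, §4.11–4.12)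

Proof-only file of the abc-iut cell (Cor. 3.12 sub-crew, seat abc-iut-c312-1 = holder of record of the typed [IUTchIII] Thm. 3.11, gens 16–17, row «R23 C:UNION-JUNCTION»; reading-(U)
twin of `GenuineLogThetaPerImageTameContent` (row «R22» (α), p540946)).  CONTAINER statements only (no `JannsenWingbergMappingClass`, no
sub-indeterminacy): classical local algebra about the Dupuy–Hilado / [IUTchIV] §1 objects of the tree; TAKES NO SIDE on [IUTchIII] Cor. 3.12.

In reading (U) ([IUTchIII] Cor. 3.12 p. 174: the hull of the UNION of the possible images; the cell's `PrimePacket.negLogThetaAt`, abc-iut-c312-3),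
the region at a summand `v⃗ = e` of degree `j = i+1` is the (Ind2)-orbit of the SLOT UNION `M_U = ⋃_a ι_a(t_{i,v_a})·(R_I)^∼` (c312-3
`realPrimePacketWith_possibleImages_pilotRegion_eq`).  At a TAME tuple each slot twist has content `A_a = (v_a − 1) div e_a + 1 − |I|` w.r.t.
`log_p(R_I^×)` (p540946 `TameContent.content_iota_smul_normalizedPacket`, `‖t_a‖ = p^{−v_a/e_a}`), so:

* §1 **`TameContent.content_iUnion_iota_smul_normalizedPacket`** — the content pair of the slot union: `M_U ⊆ p^{m}·L` and `M_U ⊄ p^{m+1}·L` with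
  **`m = min_a A_a`** (`Finset.univ.inf'`; the minimising slot carries the witness `ι_a(t_a)`); **`TameContent.packetHull_orbit_iUnion_iota_smul_normalizedPacket_eq`**
  — `packetHull(⋃_{γ ∈ indTwo} γ·M_U) = packetHull(p^{m}·L)` (abc-iut-w5-d180 `packetHull_orbit_eq_zpow`), UNCONDITIONALLY, every integral structure;
* §2 (real prime packet over ANY local-field family, abc-iut-c312-3) **`realPrimePacketWith_possibleImagesHull_pilotRegion_eq_of_tame`** and
  **`realPrimePacketWith_negLogThetaAt_eq_of_tame`**: at a prime over which every field of the family is TAME,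
  `−|log(Θ)|_p = (1/ℓ⋆)·Σ_i Σ_{v⃗} (−(min_a A_a(i,v⃗))·log p + log μ̄(hull(log_p(R_{v⃗}^×))))·Π_b Pr(v_b)` EXACTLY (c312-3's
  `realPrimePacketWith_negLogThetaAt_eq_of_content` fed with the content pair); §3 input level `ThetaVolumeInput.negLogThetaLoc_eq_of_tame`.
WHAT IS (NOT) NEEDED: only `p > 2` and tameness of every factor; no degree / parity / residue-degree hypothesis.  Residues: `p = 2`, wild fields.
HONEST SCOPE: (Ind1) = factor permutations and (Ind2) = the container `indTwo` as typed by the tree (Dupuy–Hilado §4.7/§4.9); the hull = abc-iut-S2's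
`(R_I)^∼`-span; nothing here bears on which reading or which indeterminacy group print means; typed ≠ proved; no side taken; NO abc claim.
[cite: Mochizuki2012, IUTchIV Prop. 1.1 p. 9, Prop. 1.2 (ii) p. 10–11] [cite: Mochizuki2012, IUTchIII Cor. 3.12 p. 174]
[cite: DupuyHilado2025, §4.7, §4.9, §4.11, §4.12] [claim: Mochizuki2012, status: disputed] for every IUT quotation.  PROOF-ONLY: no definitions, no `Prop` facts.
-/

set_option autoImplicit false

noncomputable section

open Set Module Function NumberField IsDedekindDomain
open scoped Pointwise TensorProduct NormedField

namespace Literature.IUT.LogVolume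

namespace TameContent

section Packet

variable (p : ℕ) [hp : Fact p.Prime]
variable {I : Type} [Fintype I] [DecidableEq I] [Nonempty I]
variable (k : I → Type) [∀ i, NontriviallyNormedField (k i)] [∀ i, NormedAlgebra ℚ_[p] (k i)]
  [∀ i, IsUltrametricDist (k i)] [∀ i, ProperSpace (k i)]

/-! ## §1 The content of the slot union at a tame tuple -/

/-- **THE CONTENT PAIR OF THE SLOT UNION at a TAME tuple**: for `g_a ∈ k_a` with `‖g_a‖ = p^{−v_a/e_a}` and `A_a = (v_a − 1) div e_a + 1 − |I|`,
`⋃_a ι_a(g_a)·(R_I)^∼ ⊆ p^{m}·log_p(R_I^×)` and `⊄ p^{m+1}·log_p(R_I^×)` with `m = min_a A_a`: each slot twist has content exactly `A_a`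
(`content_iota_smul_normalizedPacket`), and the minimising slot carries the witness. [cite: Mochizuki2012, IUTchIV Prop. 1.1 p. 9, Prop. 1.2 (ii) p. 10–11]
[cite: DupuyHilado2025, §4.7, §4.9] -/
theorem content_iUnion_iota_smul_normalizedPacket (hp2 : 2 < p) (he : ∀ i, absRamificationIdx p (k i) ≤ p - 2)
    (g : Π i, k i) (v : I → ℤ) (hg : ∀ i, ‖g i‖ = (p : ℝ) ^ (-(v i / (absRamificationIdx p (k i) : ℝ)))) :
    (⋃ a, iota p k a (g a) • (normalizedPacket p k : Set (PacketAlgebra p k))) ⊆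
        ((p : ℚ_[p]) ^ (Finset.univ.inf' Finset.univ_nonempty
            (fun a => (v a - 1) / (absRamificationIdx p (k a) : ℤ) + 1 - Fintype.card I))) •
          (logPacket p k : Set (PacketAlgebra p k)) ∧
      ¬ (⋃ a, iota p k a (g a) • (normalizedPacket p k : Set (PacketAlgebra p k))) ⊆
        ((p : ℚ_[p]) ^ (Finset.univ.inf' Finset.univ_nonempty
            (fun a => (v a - 1) / (absRamificationIdx p (k a) : ℤ) + 1 - Fintype.card I) + 1)) •
          (logPacket p k : Set (PacketAlgebra p k)) := by
  set A : I → ℤ := fun a => (v a - 1) / (absRamificationIdx p (k a) : ℤ) + 1 - Fintype.card I with hA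
  set m : ℤ := Finset.univ.inf' Finset.univ_nonempty A with hm
  refine ⟨Set.iUnion_subset fun a => ?_, fun h => ?_⟩
  · exact ((content_iota_smul_normalizedPacket p k hp2 he a (hg a)).1).trans
      (zpow_smul_logPacket_anti p k (Finset.inf'_le A (Finset.mem_univ a)))
  · obtain ⟨a₀, -, ha₀⟩ := Finset.exists_mem_eq_inf' Finset.univ_nonempty A
    have hmem : iota p k a₀ (g a₀) ∈ ⋃ a, iota p k a (g a) • (normalizedPacket p k : Set (PacketAlgebra p k)) :=
      Set.mem_iUnion.mpr ⟨a₀, 1, (normalizedPacket p k).one_mem, mul_one _⟩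
    have h' := h hmem
    rw [hm, ha₀] at h'
    exact iota_not_mem_zpow_smul_logPacket p k hp2 he a₀ (hg a₀) h'

/-- **THE `(R_I)^∼`-HULL OF THE CONTAINER ORBIT OF THE SLOT UNION at a TAME tuple** (UNCONDITIONAL):
`packetHull(⋃_{γ ∈ indTwo} γ·⋃_a ι_a(g_a)·(R_I)^∼) = packetHull(p^{min_a A_a}·log_p(R_I^×))` (abc-iut-w5-d180 `packetHull_orbit_eq_zpow`).
[cite: Mochizuki2012, IUTchIV Prop. 1.2 (ii) p. 10–11] [cite: DupuyHilado2025, §4.9, §4.11, §4.12] -/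
theorem packetHull_orbit_iUnion_iota_smul_normalizedPacket_eq (hp2 : 2 < p) (he : ∀ i, absRamificationIdx p (k i) ≤ p - 2)
    (g : Π i, k i) (v : I → ℤ) (hg : ∀ i, ‖g i‖ = (p : ℝ) ^ (-(v i / (absRamificationIdx p (k i) : ℝ)))) :
    packetHull p k (⋃ γ : indTwo p k, γ • ⋃ a, iota p k a (g a) • (normalizedPacket p k : Set (PacketAlgebra p k))) =
      packetHull p k (((p : ℚ_[p]) ^ (Finset.univ.inf' Finset.univ_nonempty
          (fun a => (v a - 1) / (absRamificationIdx p (k a) : ℤ) + 1 - Fintype.card I))) •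
        (logPacket p k : Set (PacketAlgebra p k))) := by
  set A : I → ℤ := fun a => (v a - 1) / (absRamificationIdx p (k a) : ℤ) + 1 - Fintype.card I with hA
  obtain ⟨hsub, -⟩ := content_iUnion_iota_smul_normalizedPacket p k hp2 he g v hg
  obtain ⟨a₀, -, ha₀⟩ := Finset.exists_mem_eq_inf' Finset.univ_nonempty A
  have hmem : iota p k a₀ (g a₀) ∈ ⋃ a, iota p k a (g a) • (normalizedPacket p k : Set (PacketAlgebra p k)) :=
    Set.mem_iUnion.mpr ⟨a₀, 1, (normalizedPacket p k).one_mem, mul_one _⟩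
  refine packetHull_orbit_eq_zpow p k hmem ?_ hsub
  rw [ha₀]
  exact iota_not_mem_zpow_smul_logPacket p k hp2 he a₀ (hg a₀)

end Packet

end TameContent

/-! ## §2 The real prime packet: the hull of the possible images of `O_𝕃(−P_Θ)` and `−|log(Θ)|_p` (reading (U)), exactly -/

section RealPacketWith

variable {F : Type} [Field F] [NumberField F]
variable (p : ℕ) [hp : Fact p.Prime] (𝔽 : LocalFields F p)
variable (c : (j : ℕ) → (Fin (j + 1) → placesOver F p) → ℚ_[p]) (hc0 : ∀ j e, c j e ≠ 0)
  (hcσ : ∀ (j : ℕ) (σ : Equiv.Perm (Fin (j + 1))) (e : Fin (j + 1) → placesOver F p), c j (e ∘ σ) = c j e)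

/-- **THE HULL OF THE POSSIBLE IMAGES OF THE Θ-REGION AT A TAME COLLECTION, EXACTLY (reading (U); unconditional).**  Real prime packet over ANY
local-field family; Θ-idele `t`; degree `j = i+1`; collection `v⃗ = e` with every field TAME; if `‖t_{i,v_a}‖ = p^{−v_a/e(K_{v̲_a})}` for every slot `a`,
then `hull(⋃_{g,σ} g·σ·O_𝕃(−P_Θ)) = packetHull(p^{min_a A_a}·log_p(R_I^×))`, `A_a = (v_a − 1) div e(K_{v̲_a}) + 1 − (j+1)`.
[cite: Mochizuki2012, IUTchIII Cor. 3.12 p. 174; IUTchIV Prop. 1.2 (ii) p. 10–11] [cite: DupuyHilado2025, §4.7, §4.11, §4.12]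
[claim: Mochizuki2012, status: disputed] -/
theorem realPrimePacketWith_possibleImagesHull_pilotRegion_eq_of_tame (hp2 : 2 < p) {lstar : ℕ}
    (t : Fin lstar → (v : placesOver F p) → (𝔽.k v)ˣ) (i : Fin lstar) (e : Fin ((i : ℕ) + 1 + 1) → placesOver F p)
    (he : ∀ b, absRamificationIdx p (𝔽.k (e b)) ≤ p - 2) (v : Fin ((i : ℕ) + 1 + 1) → ℤ)
    (hv : ∀ a, ‖(t i (e a) : 𝔽.k (e a))‖ = (p : ℝ) ^ (-(v a / (absRamificationIdx p (𝔽.k (e a)) : ℝ)))) :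
    (realPrimePacketWith p 𝔽 c hc0 hcσ).possibleImagesHull ((realPrimePacketWith p 𝔽 c hc0 hcσ).pilotRegion t) ((i : ℕ) + 1) e =
      packetHull p (fun b => 𝔽.k (e b))
        (((p : ℚ_[p]) ^ (Finset.univ.inf' Finset.univ_nonempty
            (fun a => (v a - 1) / (absRamificationIdx p (𝔽.k (e a)) : ℤ) + 1 - Fintype.card (Fin ((i : ℕ) + 1 + 1))))) •
          (logPacket p (fun b => 𝔽.k (e b)) : Set (PacketAlgebra p (fun b => 𝔽.k (e b))))) := by
  change packetHull p (fun b => 𝔽.k (e b)) ((realPrimePacketWith p 𝔽 c hc0 hcσ).possibleImages _ _ e) = _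
  rw [realPrimePacketWith_possibleImages_pilotRegion_eq]
  exact TameContent.packetHull_orbit_iUnion_iota_smul_normalizedPacket_eq p (fun b => 𝔽.k (e b)) hp2 he
    (fun a => (t i (e a) : 𝔽.k (e a))) v hv

/-- **`−|log(Θ)|_p` (READING (U)) AT A TAME PRIME, EXACTLY (unconditional).**  If every field `K_{v̲}`, `v ∣ p`, of the family is TAME and
`v(i,v⃗,a) ∈ ℤ` records the valuations `‖t_{i,v_a}‖ = p^{−v/e(K_{v̲_a})}` of the Θ-idele at every slot, then
`−|log(Θ)|_p = (1/ℓ⋆)·Σ_i Σ_{v⃗} (−(min_a A(i,v⃗,a))·log p + log μ̄(hull(log_p(R_{v⃗}^×))))·Π_b Pr(v_b)`, `A(i,v⃗,a) = (v(i,v⃗,a) − 1) div e(K_{v̲_a}) + 1 − (j+1)`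
(abc-iut-c312-3's `realPrimePacketWith_negLogThetaAt_eq_of_content` fed with the content pair of the slot union).
[cite: Mochizuki2012, IUTchIII Cor. 3.12 p. 174] [cite: DupuyHilado2025, Def. 3.6.3, §4.11, §4.12] [claim: Mochizuki2012, status: disputed] -/
theorem realPrimePacketWith_negLogThetaAt_eq_of_tame (hp2 : 2 < p) {lstar : ℕ}
    (t : Fin lstar → (v : placesOver F p) → (𝔽.k v)ˣ)
    (he : ∀ w : placesOver F p, absRamificationIdx p (𝔽.k w) ≤ p - 2)
    (v : (i : Fin lstar) → (Fin ((i : ℕ) + 1 + 1) → placesOver F p) → Fin ((i : ℕ) + 1 + 1) → ℤ)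
    (hv : ∀ (i : Fin lstar) (e : Fin ((i : ℕ) + 1 + 1) → placesOver F p) (a : Fin ((i : ℕ) + 1 + 1)),
      ‖(t i (e a) : 𝔽.k (e a))‖ = (p : ℝ) ^ (-(v i e a / (absRamificationIdx p (𝔽.k (e a)) : ℝ)))) :
    (realPrimePacketWith p 𝔽 c hc0 hcσ).negLogThetaAt lstar t =
      (1 / (lstar : ℝ)) * ∑ i : Fin lstar, ∑ e : Fin ((i : ℕ) + 1 + 1) → placesOver F p,
        (-((Finset.univ.inf' Finset.univ_nonempty
              (fun a => (v i e a - 1) / (absRamificationIdx p (𝔽.k (e a)) : ℤ) + 1 - Fintype.card (Fin ((i : ℕ) + 1 + 1))) : ℤ) *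
            Real.log p) +
          packetLogμ p (fun b => 𝔽.k (e b))
            (packetHull p (fun b => 𝔽.k (e b))
              (logPacket p (fun b => 𝔽.k (e b)) : Set (PacketAlgebra p (fun b => 𝔽.k (e b)))))) *
          ∏ b, weight F (e b).1 :=
  realPrimePacketWith_negLogThetaAt_eq_of_content p 𝔽 c hc0 hcσ t
    (fun i e => Finset.univ.inf' Finset.univ_nonempty
      (fun a => (v i e a - 1) / (absRamificationIdx p (𝔽.k (e a)) : ℤ) + 1 - Fintype.card (Fin ((i : ℕ) + 1 + 1))))
    fun i e => TameContent.content_iUnion_iota_smul_normalizedPacket p (fun b => 𝔽.k (e b)) hp2 (fun b => he (e b))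
      (fun a => (t i (e a) : 𝔽.k (e a))) (v i e) (hv i e)

/-- **READING (U) MINUS READING (P) AT A TAME PRIME, EXACTLY**: with `v(i,v⃗,a)` the slot valuations of the Θ-idele and
`A(i,v⃗,a) = (v(i,v⃗,a) − 1) div e(K_{v̲_a}) + 1 − (j+1)`,
`−|log(Θ)|_p − (−|log(Θ)|^{(P)}_p) = (log p/ℓ⋆)·Σ_i Σ_{v⃗} (A(i,v⃗,j) − min_a A(i,v⃗,a))·Π_b Pr(v_b)` — the slot defect of abc-iut-s2-p2's
`realPrimePacketWith_negLogThetaAt_perImage_two_sided` (there up to `± log p`), now an IDENTITY at tame primes (both readings read the same lattice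
constant `log μ̄(hull(log_p(R_I^×)))`). [cite: Mochizuki2012, IUTchIII Cor. 3.12 p. 174; proof Step (x) pp. 180–181] [cite: DupuyHilado2025, Def. 3.6.3, §4.7, §4.12]
[claim: Mochizuki2012, status: disputed] -/
theorem realPrimePacketWith_negLogThetaAt_sub_negLogThetaPerImageAt_eq_of_tame (hp2 : 2 < p) {lstar : ℕ}
    (t : Fin lstar → (v : placesOver F p) → (𝔽.k v)ˣ)
    (he : ∀ w : placesOver F p, absRamificationIdx p (𝔽.k w) ≤ p - 2)
    (v : (i : Fin lstar) → (Fin ((i : ℕ) + 1 + 1) → placesOver F p) → Fin ((i : ℕ) + 1 + 1) → ℤ)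
    (hv : ∀ (i : Fin lstar) (e : Fin ((i : ℕ) + 1 + 1) → placesOver F p) (a : Fin ((i : ℕ) + 1 + 1)),
      ‖(t i (e a) : 𝔽.k (e a))‖ = (p : ℝ) ^ (-(v i e a / (absRamificationIdx p (𝔽.k (e a)) : ℝ)))) :
    (realPrimePacketWith p 𝔽 c hc0 hcσ).negLogThetaAt lstar t -
        (realPrimePacketWith p 𝔽 c hc0 hcσ).negLogThetaPerImageAt lstar t =
      (1 / (lstar : ℝ)) * ∑ i : Fin lstar, ∑ e : Fin ((i : ℕ) + 1 + 1) → placesOver F p,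
        ((((v i e (Fin.last _) - 1) / (absRamificationIdx p (𝔽.k (e (Fin.last _))) : ℤ) + 1 -
              Fintype.card (Fin ((i : ℕ) + 1 + 1))) -
            Finset.univ.inf' Finset.univ_nonempty
              (fun a => (v i e a - 1) / (absRamificationIdx p (𝔽.k (e a)) : ℤ) + 1 - Fintype.card (Fin ((i : ℕ) + 1 + 1))) : ℤ) : ℝ) *
          Real.log p * ∏ b, weight F (e b).1 := by
  rw [realPrimePacketWith_negLogThetaAt_eq_of_tame p 𝔽 c hc0 hcσ hp2 t he v hv,
    realPrimePacketWith_negLogThetaPerImageAt_eq_of_tame p 𝔽 c hc0 hcσ hp2 t he (fun i e => v i e (Fin.last _))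
      (fun i e => hv i e (Fin.last _)), ← mul_sub, ← Finset.sum_sub_distrib]
  refine congrArg (fun x : ℝ => (1 / (lstar : ℝ)) * x) (Finset.sum_congr rfl fun i _ => ?_)
  rw [← Finset.sum_sub_distrib]
  refine Finset.sum_congr rfl fun e _ => ?_
  push_cast
  ring

end RealPacketWith

/-! ## §3 Input level: the `p`-summand of `−|log(Θ)|` (reading (U)) of a genuine Θ-volume input at a tame prime -/

namespace ThetaVolumeInput

variable {F₀ : Type} [Field F₀] [NumberField F₀] {K : Type} [Field K] [NumberField K] [Algebra F₀ K]
variable (I : ThetaVolumeInput F₀ K)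

/-- **INPUT LEVEL, reading (U)** (Mochizuki's shell normalisation `packetAt`; genuine completions of the section): at a prime `p > 2` over which every
place `v̲` of the section is TAME, with `v(i,v⃗,a) ∈ ℤ` the slot valuations of `t_Θ`:
`negLogThetaLoc I p = (1/ℓ⋆)·Σ_i Σ_{v⃗} (−(min_a A(i,v⃗,a))·log p + log μ̄(hull(log_p(R_{v⃗}^×))))·Π_b Pr(v_b)`.
[cite: Mochizuki2012, IUTchIII Cor. 3.12 p. 174] [cite: DupuyHilado2025, Def. 3.6.3, §4.12] [claim: Mochizuki2012, status: disputed] -/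
theorem negLogThetaLoc_eq_of_tame {p : ℕ} (hpp : p.Prime) (hp2 : 2 < p)
    (he : haveI : Fact p.Prime := ⟨hpp⟩; ∀ w : placesOver F₀ p, absRamificationIdx p ((I.σ.localFields p).k w) ≤ p - 2)
    (v : haveI : Fact p.Prime := ⟨hpp⟩; (i : Fin I.lstar) → (Fin ((i : ℕ) + 1 + 1) → placesOver F₀ p) → Fin ((i : ℕ) + 1 + 1) → ℤ)
    (hv : haveI : Fact p.Prime := ⟨hpp⟩; ∀ (i : Fin I.lstar) (e : Fin ((i : ℕ) + 1 + 1) → placesOver F₀ p) (a : Fin ((i : ℕ) + 1 + 1)),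
      ‖(I.tΘ p hpp i (e a) : (I.σ.localFieldFamily p hpp).k (e a))‖ =
        (p : ℝ) ^ (-(v i e a / (absRamificationIdx p ((I.σ.localFieldFamily p hpp).k (e a)) : ℝ)))) :
    haveI : Fact p.Prime := ⟨hpp⟩
    I.negLogThetaLoc p =
      (1 / (I.lstar : ℝ)) * ∑ i : Fin I.lstar, ∑ e : Fin ((i : ℕ) + 1 + 1) → placesOver F₀ p,
        (-((Finset.univ.inf' Finset.univ_nonempty
              (fun a => (v i e a - 1) / (absRamificationIdx p ((I.σ.localFields p).k (e a)) : ℤ) + 1 -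
                Fintype.card (Fin ((i : ℕ) + 1 + 1))) : ℤ) * Real.log p) +
          packetLogμ p (fun b => (I.σ.localFields p).k (e b))
            (packetHull p (fun b => (I.σ.localFields p).k (e b))
              (logPacket p (fun b => (I.σ.localFields p).k (e b)) :
                Set (PacketAlgebra p (fun b => (I.σ.localFields p).k (e b)))))) *
          ∏ b, weight F₀ (e b).1 := by
  haveI : Fact p.Prime := ⟨hpp⟩
  rw [negLogThetaLoc_of_prime I hpp]
  exact realPrimePacketWith_negLogThetaAt_eq_of_tame p (I.σ.localFields p) (mScale p (I.σ.localFields p))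
    (mScale_ne_zero p (I.σ.localFields p)) (mScale_perm p (I.σ.localFields p)) hp2 (I.tΘ p hpp) he v hv

end ThetaVolumeInput

end Literature.IUT.LogVolume

end
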